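import Mathlib
import Literature.NumberTheory.Automorphic.GaloisActionPlaces
import Summits.Langlands.Langlands.Theorems.PicardMuOrdinaryIrregularClassicalityBaseChangeToLField
import HarnessLib

/-!
# `λ` splits in `L = K(√-2)`: every place of `L` above `3` has residue degree `1` and is unramified
# over `K` (line `split-ramified-prime-sqrt6`, crux stmt-Langlands-13758)

`K = ℚ(ω) = CyclotomicField 3 ℚ`.  For ANY quadratic extension `L ⊇ K` containing `s` with
`s² = -2` (the shape in which the landed Stub 4 delivers `L`, `exists_cmField_sqrt_neg_two`), every
place `w` of `L` with `3 ∈ w` satisfies `f(w | w ∩ 𝓞 K) = 1` and `e = 1`: the unique place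
`λ = (1 - ω)` of `K` above `3` SPLITS in `L`, so `L_w = K_λ` — the fact by which the ordinary avatars
`r_k|_{Γ_{K_λ}}` of the line's heart are ordinary over `L` ("`L_u = K_λ`", skeleton docstring).

Proof (`inertiaDeg_eq_one_of_sq_eq_neg_two`): `L/K` is Galois of degree `2`; its non-trivial
automorphism `σ` has `σ s = -s` (`σ s = ±s`, and `σ s = s` would give `σ = 1` because `L = K(s)`:
`s ∉ K` as `-2` is not a square in `K`, `sq_ne_neg_two`).  In the residue field of `w`
(characteristic `3`) `s² = -2 = 1`, so `s - ε ∈ w` for some `ε = ±1`; then `σ(s - ε) = -s - ε ∈ σ • w`,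
and `σ • w = w` would put `(s - ε) - (-s - ε)·(-1)…`, precisely `-2ε = (s - ε) + (-s - ε) ∈ w`,
i.e. `2 ∈ w ∋ 3`, absurd.  Hence `w ≠ σ • w` are two primes over `v = w ∩ 𝓞 K`, and the fundamental
identity `g·e·f = [L : K] = 2` (Mathlib `Ideal.ncard_primesOver_mul_ramificationIdxIn_mul_inertiaDegIn`)
forces `e = f = 1`.

References: J. Neukirch, *Algebraic Number Theory* (1999), Ch. I (8.2)–(8.4), (9.2). [folklore]
-/

open scoped Pointwise
open IsDedekindDomain NumberField Polynomial
open Literature.NumberTheory.Automorphic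

set_option linter.dupNamespace false -- project-wide: `Summit.Langlands.Langlands` is the mandated namespace

noncomputable section

namespace Summit.Langlands.Langlands.Theorems.IrregularClassicality.SplitRamifiedPrimeSqrt6

variable {L : Type} [Field L] [NumberField L] [Algebra (CyclotomicField 3 ℚ) L]

/-- **The `K`-involution of `L = K(s)`, `s² = -2`**: for `[L : K] = 2` there is `σ ∈ Aut(L/K)` with
`σ s = -s`. [folklore] -/
theorem exists_algEquiv_apply_eq_neg (h2 : Module.finrank (CyclotomicField 3 ℚ) L = 2) {s : L}
    (hs : s ^ 2 = -2) : ∃ σ : L ≃ₐ[CyclotomicField 3 ℚ] L, σ s = -s := by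
  haveI : FiniteDimensional (CyclotomicField 3 ℚ) L := Module.finite_of_finrank_eq_succ h2
  haveI : Algebra.IsQuadraticExtension (CyclotomicField 3 ℚ) L := ⟨h2⟩
  haveI : IsGalois (CyclotomicField 3 ℚ) L := inferInstance
  -- `s ∉ K`, so `L = K(s)`
  haveI : IsCyclotomicExtension {3} ℚ (CyclotomicField 3 ℚ) :=
    CyclotomicField.isCyclotomicExtension 3 ℚ
  have hsK : s ∉ (algebraMap (CyclotomicField 3 ℚ) L).range := by
    rintro ⟨b, hb⟩
    have hb2 : algebraMap (CyclotomicField 3 ℚ) L (b ^ 2) = algebraMap (CyclotomicField 3 ℚ) L (-2) := by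
      rw [map_pow, hb, hs, map_neg, map_ofNat]
    exact sq_ne_neg_two b ((algebraMap (CyclotomicField 3 ℚ) L).injective hb2)
  have hint : IsIntegral (CyclotomicField 3 ℚ) s := IsIntegral.of_finite _ s
  have htop : IntermediateField.adjoin (CyclotomicField 3 ℚ) {s} = ⊤ := by
    refine IntermediateField.eq_of_le_of_finrank_eq le_top ?_
    rw [IntermediateField.adjoin.finrank hint, IntermediateField.finrank_top', h2]
    refine le_antisymm ?_ ((minpoly.two_le_natDegree_iff hint).2 hsK)
    exact h2 ▸ minpoly.natDegree_le s
  -- a non-trivial automorphism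
  obtain ⟨σ, hσ⟩ : ∃ σ : L ≃ₐ[CyclotomicField 3 ℚ] L, σ ≠ 1 := by
    by_contra h
    push Not at h
    haveI : Subsingleton (L ≃ₐ[CyclotomicField 3 ℚ] L) := ⟨fun a b => (h a).trans (h b).symm⟩
    have h1 := Nat.card_of_subsingleton (1 : L ≃ₐ[CyclotomicField 3 ℚ] L)
    have h2' := IsGalois.card_aut_eq_finrank (CyclotomicField 3 ℚ) L
    rw [h2] at h2'
    omega
  refine ⟨σ, ?_⟩
  have hsq : (σ s) ^ 2 = -2 := by rw [← map_pow, hs, map_neg, map_ofNat]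
  have hmul : (σ s - s) * (σ s + s) = 0 := by linear_combination hsq - hs
  rcases mul_eq_zero.1 hmul with h | h
  · -- `σ s = s` forces `σ = 1`
    exfalso
    apply hσ
    have hss : σ s = s := by linear_combination h
    apply AlgEquiv.ext
    intro x
    have hx : x ∈ IntermediateField.adjoin (CyclotomicField 3 ℚ) {s} := by
      rw [htop]; exact IntermediateField.mem_top
    induction hx using IntermediateField.adjoin_induction with
    | mem y hy => rw [Set.mem_singleton_iff.mp hy, hss]; rfl
    | algebraMap r => rw [AlgEquiv.commutes]; rfl
    | add y z _ _ hy hz => rw [map_add, hy, hz]; rfl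
    | mul y z _ _ hy hz => rw [map_mul, hy, hz]; rfl
    | inv y _ hy => rw [map_inv₀, hy]; rfl
  · linear_combination h

/-- **`λ` splits in `L ⊇ K(√-2)`**: for `[L : K] = 2` and `s ∈ L` with `s² = -2`, every place `w`
of `L` above `3` is unramified over `K` with residue degree `1` (so `L_w = K_λ`).  See the module
docstring. [folklore] -/
theorem ramificationIdxIn_eq_one_and_inertiaDeg_eq_one_of_sq_eq_neg_two
    (h2 : Module.finrank (CyclotomicField 3 ℚ) L = 2) {s : L} (hs : s ^ 2 = -2)
    (w : HeightOneSpectrum (𝓞 L)) (h3 : ((3 : ℕ) : 𝓞 L) ∈ w.asIdeal) :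
    (w.under (𝓞 (CyclotomicField 3 ℚ))).asIdeal.ramificationIdxIn (𝓞 L) = 1 ∧
      w.asIdeal.inertiaDeg (𝓞 (CyclotomicField 3 ℚ)) = 1 := by
  classical
  haveI : FiniteDimensional (CyclotomicField 3 ℚ) L := Module.finite_of_finrank_eq_succ h2
  haveI : Algebra.IsQuadraticExtension (CyclotomicField 3 ℚ) L := ⟨h2⟩
  haveI : IsGalois (CyclotomicField 3 ℚ) L := inferInstance
  obtain ⟨σ, hσs⟩ := exists_algEquiv_apply_eq_neg h2 hs
  -- `s` as an algebraic integer, and `s ≡ ±1 (mod w)`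
  have hsint : IsIntegral ℤ s := by
    refine IsIntegral.of_pow (n := 2) two_pos ?_
    rw [hs, show (-2 : L) = algebraMap ℤ L (-2) by simp]
    exact isIntegral_algebraMap
  set s' : 𝓞 L := ⟨s, hsint⟩ with hs'def
  have hcoe : (s' : L) = s := rfl
  have hs' : s' ^ 2 = -2 := by
    apply RingOfIntegers.ext
    rw [RingOfIntegers.ext_iff] at *
    push_cast [hcoe]
    exact hs
  haveI : w.asIdeal.IsPrime := w.isPrime
  have h3' : (3 : 𝓞 L) ∈ w.asIdeal := by exact_mod_cast h3
  have hprod : (s' - 1) * (s' + 1) ∈ w.asIdeal := by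
    have : (s' - 1) * (s' + 1) = -(3 : 𝓞 L) := by linear_combination hs'
    rw [this]; exact w.asIdeal.neg_mem_iff.mpr h3'
  -- the conjugate prime `σ • w` is different from `w`
  have hne : σ • w ≠ w := by
    intro heq
    have h2mem : (2 : 𝓞 L) ∈ w.asIdeal := by
      have hσs' : σ • s' = -s' := RingOfIntegers.ext (by
        rw [RingOfIntegers.coe_algEquiv_smul]; simp [hs'def, hσs])
      rcases (Ideal.IsPrime.mem_or_mem inferInstance hprod) with h | h
      · -- `s - 1 ∈ w` and `σ (s - 1) = -s - 1 ∈ σ • w = w`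
        have hmem : σ • (s' - 1) ∈ (σ • w).asIdeal :=
          (HeightOneSpectrum.smul_mem_smul_asIdeal_iff σ w _).2 h
        rw [heq, smul_sub, hσs', smul_one] at hmem
        have := w.asIdeal.add_mem h hmem
        have e : (s' - 1) + (-s' - 1) = -(2 : 𝓞 L) := by ring
        rw [e] at this
        exact w.asIdeal.neg_mem_iff.mp this
      · have hmem : σ • (s' + 1) ∈ (σ • w).asIdeal :=
          (HeightOneSpectrum.smul_mem_smul_asIdeal_iff σ w _).2 h
        rw [heq, smul_add, hσs', smul_one] at hmem
        have := w.asIdeal.add_mem h hmem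
        have e' : (s' + 1) + (-s' + 1) = (2 : 𝓞 L) := by ring
        rwa [e'] at this
    have h1 : (1 : 𝓞 L) ∈ w.asIdeal := by
      have := w.asIdeal.sub_mem h3' h2mem
      have e : (3 : 𝓞 L) - 2 = 1 := by norm_num
      rwa [e] at this
    exact w.isPrime.ne_top ((Ideal.eq_top_iff_one _).mpr h1)
  -- both lie over `v = w ∩ 𝓞 K`; the fundamental identity `g e f = 2` forces `g = 2`, `e = f = 1`
  set v := w.under (𝓞 (CyclotomicField 3 ℚ)) with hv
  haveI : v.asIdeal.IsMaximal := v.isMaximal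
  haveI hwo : w.asIdeal.LiesOver v.asIdeal := ⟨by rw [hv, HeightOneSpectrum.under_asIdeal, Ideal.under]⟩
  have hσw : (σ • w).under (𝓞 (CyclotomicField 3 ℚ)) = v := by
    rw [hv]; exact HeightOneSpectrum.under_algEquiv_smul (CyclotomicField 3 ℚ) L σ w
  haveI hσwo : (σ • w).asIdeal.LiesOver v.asIdeal :=
    ⟨by rw [← hσw, HeightOneSpectrum.under_asIdeal, Ideal.under]⟩
  have hmemw : w.asIdeal ∈ v.asIdeal.primesOver (𝓞 L) := ⟨w.isPrime, hwo⟩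
  have hmemσ : (σ • w).asIdeal ∈ v.asIdeal.primesOver (𝓞 L) := ⟨(σ • w).isPrime, hσwo⟩
  have hne' : (σ • w).asIdeal ≠ w.asIdeal := fun h => hne (HeightOneSpectrum.ext h)
  have hfin : (v.asIdeal.primesOver (𝓞 L)).Finite := IsDedekindDomain.primesOver_finite _ _
  have hcard2 : 2 ≤ (v.asIdeal.primesOver (𝓞 L)).ncard := by
    have hsub : ({w.asIdeal, (σ • w).asIdeal} : Set (Ideal (𝓞 L))) ⊆ v.asIdeal.primesOver (𝓞 L) := by
      intro I hI
      rcases hI with rfl | rfl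
      · exact hmemw
      · exact hmemσ
    have := Set.ncard_le_ncard hsub hfin
    rwa [Set.ncard_pair hne'.symm] at this
  have hfund := Ideal.ncard_primesOver_mul_ramificationIdxIn_mul_inertiaDegIn v.asIdeal (𝓞 L)
    (L ≃ₐ[CyclotomicField 3 ℚ] L)
  rw [IsGalois.card_aut_eq_finrank, h2] at hfund
  set e := v.asIdeal.ramificationIdxIn (𝓞 L) with he_def
  set f := v.asIdeal.inertiaDegIn (𝓞 L) with hf_def
  set g := (v.asIdeal.primesOver (𝓞 L)).ncard with hg_def
  have hef0 : e * f ≠ 0 := by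
    intro h0; rw [h0, mul_zero] at hfund; exact two_ne_zero hfund.symm
  have he0 : e ≠ 0 := fun h => hef0 (by rw [h, zero_mul])
  have hf0 : f ≠ 0 := fun h => hef0 (by rw [h, mul_zero])
  have hef1 : e * f = 1 := by
    by_contra h1
    have h2ef : 2 ≤ e * f := by omega
    have := Nat.mul_le_mul hcard2 h2ef
    omega
  have he1 : e = 1 := Nat.eq_one_of_mul_eq_one_right hef1
  have hf1 : f = 1 := Nat.eq_one_of_mul_eq_one_left hef1
  refine ⟨he1, ?_⟩
  rw [← Ideal.inertiaDegIn_eq_inertiaDeg v.asIdeal w.asIdeal (L ≃ₐ[CyclotomicField 3 ℚ] L)]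
  exact hf1

/-- **`λ` splits in `L ⊇ K(√-2)`** — closed form of
`ramificationIdxIn_eq_one_and_inertiaDeg_eq_one_of_sq_eq_neg_two` (registered helper of the crux item:
the shape in which the line's Stub 4 delivers `L`, `[L : K] = 2` with `s² = -2`): every place of `L`
above `3` is unramified of residue degree `1` over `K`, i.e. `L_w = K_λ`. [folklore] -/
theorem lambda_splits_of_sq_eq_neg_two :
    ∀ (L : Type) [Field L] [NumberField L] [Algebra (CyclotomicField 3 ℚ) L],
      Module.finrank (CyclotomicField 3 ℚ) L = 2 → ∀ (s : L), s ^ 2 = -2 →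
      ∀ (w : HeightOneSpectrum (𝓞 L)), ((3 : ℕ) : 𝓞 L) ∈ w.asIdeal →
        (w.under (𝓞 (CyclotomicField 3 ℚ))).asIdeal.ramificationIdxIn (𝓞 L) = 1 ∧
          w.asIdeal.inertiaDeg (𝓞 (CyclotomicField 3 ℚ)) = 1 := by
  intro L _ _ _ h2 s hs w h3
  exact ramificationIdxIn_eq_one_and_inertiaDeg_eq_one_of_sq_eq_neg_two h2 hs w h3

/-! ## The places above `3` are moved by every automorphism negating `√-2`
(appended 2026-08-16, same lead): in particular by complex conjugation `c` of the CM field `L`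
(`c s = -s`), i.e. the places of `L` above `3` are SPLIT over the maximal totally real subfield
`L⁺ = L^c = ℚ(√6)` — the other half of the local picture of the heart ("`3` ramified in `L⁺` and
split in `L/L⁺`, `G'(ℚ₃) = GL₃(K_λ)` for `G' = U(2,1)_{L/L⁺}`"). -/

omit [NumberField L] [Algebra (CyclotomicField 3 ℚ) L] in
/-- **An automorphism negating `s = √-2` fixes no place above `3`.**  For `σ ∈ Aut(L/F)` (any base
field `F`) with `σ s = -s`, `s² = -2`, and a place `w ∋ 3` of `L`: `σ • w ≠ w`.  Indeed `s ≡ ε = ±1`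
modulo `w` (`s² = -2 = 1` in characteristic `3`), and `σ • w = w` would contain both `s - ε` and
`σ(s - ε) = -s - ε`, hence `2`, hence `1`. [folklore] -/
theorem smul_ne_self_of_apply_eq_neg {F : Type} [Field F] [Algebra F L] (σ : L ≃ₐ[F] L) {s : L}
    (hs : s ^ 2 = -2) (hσs : σ s = -s) (w : HeightOneSpectrum (𝓞 L))
    (h3 : ((3 : ℕ) : 𝓞 L) ∈ w.asIdeal) : σ • w ≠ w := by
  have hsint : IsIntegral ℤ s := by
    refine IsIntegral.of_pow (n := 2) two_pos ?_
    rw [hs, show (-2 : L) = algebraMap ℤ L (-2) by simp]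
    exact isIntegral_algebraMap
  set s' : 𝓞 L := ⟨s, hsint⟩ with hs'def
  have hcoe : (s' : L) = s := rfl
  have hs' : s' ^ 2 = -2 := by
    apply RingOfIntegers.ext
    rw [RingOfIntegers.ext_iff] at *
    push_cast [hcoe]
    exact hs
  haveI : w.asIdeal.IsPrime := w.isPrime
  have h3' : (3 : 𝓞 L) ∈ w.asIdeal := by exact_mod_cast h3
  have hprod : (s' - 1) * (s' + 1) ∈ w.asIdeal := by
    have : (s' - 1) * (s' + 1) = -(3 : 𝓞 L) := by linear_combination hs'
    rw [this]; exact w.asIdeal.neg_mem_iff.mpr h3'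
  intro heq
  have hσs' : σ • s' = -s' := RingOfIntegers.ext (by
    rw [RingOfIntegers.coe_algEquiv_smul]; simp [hs'def, hσs])
  have h2mem : (2 : 𝓞 L) ∈ w.asIdeal := by
    rcases (Ideal.IsPrime.mem_or_mem inferInstance hprod) with h | h
    · have hmem : σ • (s' - 1) ∈ (σ • w).asIdeal :=
        (HeightOneSpectrum.smul_mem_smul_asIdeal_iff σ w _).2 h
      rw [heq, smul_sub, hσs', smul_one] at hmem
      have := w.asIdeal.add_mem h hmem
      have e : (s' - 1) + (-s' - 1) = -(2 : 𝓞 L) := by ring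
      rw [e] at this
      exact w.asIdeal.neg_mem_iff.mp this
    · have hmem : σ • (s' + 1) ∈ (σ • w).asIdeal :=
        (HeightOneSpectrum.smul_mem_smul_asIdeal_iff σ w _).2 h
      rw [heq, smul_add, hσs', smul_one] at hmem
      have := w.asIdeal.add_mem h hmem
      have e' : (s' + 1) + (-s' + 1) = (2 : 𝓞 L) := by ring
      rwa [e'] at this
  have h1 : (1 : 𝓞 L) ∈ w.asIdeal := by
    have := w.asIdeal.sub_mem h3' h2mem
    have e : (3 : 𝓞 L) - 2 = 1 := by norm_num
    rwa [e] at this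
  exact w.isPrime.ne_top ((Ideal.eq_top_iff_one _).mpr h1)

/-- **The places of `L` above `3` are split over `L^c`** — closed form for an involution `c` of `L`
over `ℚ` with `c s = -s` (the `c` delivered with `L` by Stub 4; for the CM field `L = K(√-2)` it is
complex conjugation, so this says: `3` splits in `L/L⁺`, `L⁺ = ℚ(√6)`): `c • w ≠ w` for every place
`w ∋ 3`.  Registered helper of the crux item. [folklore] -/
theorem conj_smul_ne_self_of_sq_eq_neg_two :
    ∀ (L : Type) [Field L] [NumberField L] (c : L ≃ₐ[ℚ] L) (s : L), s ^ 2 = -2 → c s = -s →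
      ∀ (w : HeightOneSpectrum (𝓞 L)), ((3 : ℕ) : 𝓞 L) ∈ w.asIdeal → c • w ≠ w := by
  intro L _ _ c s hs hcs w h3
  exact smul_ne_self_of_apply_eq_neg c hs hcs w h3

/-! ## `L = K(s)`, and the delivered involution `c` is complex conjugation
(appended 2026-08-16, same lead): the abstract `L` of Stub 4 (`[L : K] = 2`, `s² = -2`) is generated by
`s` over `K`, so lead c1's `conjugate_eq_comp_of_sqrt` applies to it: the involution `c` (`c s = -s`,
`c|_K = c₀ ≠ 1`) is complex conjugation under EVERY embedding `L → ℂ` — whence `L^c` is the maximal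
totally real subfield `L⁺ = ℚ(√6)` of the CM field `L`, the base of the unitary group `U(2,1)_{L/L⁺}`. -/

/-- **`L = K(s)`**: for `[L : K] = 2` and `s² = -2` (so `s ∉ K`, `sq_ne_neg_two`), `Algebra.adjoin K {s}`
is all of `L`. [folklore] -/
theorem algebra_adjoin_eq_top_of_sq_eq_neg_two (h2 : Module.finrank (CyclotomicField 3 ℚ) L = 2) {s : L}
    (hs : s ^ 2 = -2) : Algebra.adjoin (CyclotomicField 3 ℚ) {s} = ⊤ := by
  haveI : FiniteDimensional (CyclotomicField 3 ℚ) L := Module.finite_of_finrank_eq_succ h2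
  haveI : IsCyclotomicExtension {3} ℚ (CyclotomicField 3 ℚ) :=
    CyclotomicField.isCyclotomicExtension 3 ℚ
  have hsK : s ∉ (algebraMap (CyclotomicField 3 ℚ) L).range := by
    rintro ⟨b, hb⟩
    have hb2 : algebraMap (CyclotomicField 3 ℚ) L (b ^ 2) = algebraMap (CyclotomicField 3 ℚ) L (-2) := by
      rw [map_pow, hb, hs, map_neg, map_ofNat]
    exact sq_ne_neg_two b ((algebraMap (CyclotomicField 3 ℚ) L).injective hb2)
  have hint : IsIntegral (CyclotomicField 3 ℚ) s := IsIntegral.of_finite _ s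
  have htop : IntermediateField.adjoin (CyclotomicField 3 ℚ) {s} = ⊤ := by
    refine IntermediateField.eq_of_le_of_finrank_eq le_top ?_
    rw [IntermediateField.adjoin.finrank hint, IntermediateField.finrank_top', h2]
    refine le_antisymm ?_ ((minpoly.two_le_natDegree_iff hint).2 hsK)
    exact h2 ▸ minpoly.natDegree_le s
  rw [← IntermediateField.adjoin_simple_toSubalgebra_of_isAlgebraic hint.isAlgebraic, htop, IntermediateField.top_toSubalgebra]

/-- **The delivered involution is complex conjugation**: for `[L : K] = 2`, `s² = -2`, `c ∈ Aut(L/ℚ)`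
with `c s = -s` restricting to `c₀ ≠ 1` on `K = ℚ(ω)`, `conj ∘ φ = φ ∘ c` for every embedding
`φ : L → ℂ` (lead c1's `conjugate_eq_comp_of_sqrt` with `conjugate_eq_comp_c₀`, on `L = K(s)`). [folklore] -/
theorem conjugate_eq_comp_of_finrank_eq_two (h2 : Module.finrank (CyclotomicField 3 ℚ) L = 2) {s : L}
    (hs : s ^ 2 = -2) (c : L ≃ₐ[ℚ] L) (hcs : c s = -s)
    (c₀ : CyclotomicField 3 ℚ ≃ₐ[ℚ] CyclotomicField 3 ℚ) (hc₀ : c₀ ≠ 1)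
    (hcc₀ : ∀ x : CyclotomicField 3 ℚ,
      c (algebraMap (CyclotomicField 3 ℚ) L x) = algebraMap (CyclotomicField 3 ℚ) L (c₀ x))
    (φ : L →+* ℂ) : ComplexEmbedding.conjugate φ = φ.comp (c : L →+* L) := by
  haveI : IsCyclotomicExtension {3} ℚ (CyclotomicField 3 ℚ) :=
    CyclotomicField.isCyclotomicExtension 3 ℚ
  exact conjugate_eq_comp_of_sqrt (algebra_adjoin_eq_top_of_sq_eq_neg_two h2 hs) hs c hcs c₀ hcc₀
    (fun ψ => conjugate_eq_comp_c₀ hc₀ ψ) φ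

/-- Closed form of `conjugate_eq_comp_of_finrank_eq_two` (registered helper of the crux item): the
involution `c` delivered with `L` by Stub 4 is complex conjugation for every complex embedding of `L`.
[folklore] -/
theorem conj_eq_complexConjugation_of_sq_eq_neg_two :
    ∀ (L : Type) [Field L] [NumberField L] [Algebra (CyclotomicField 3 ℚ) L]
      (c₀ : CyclotomicField 3 ℚ ≃ₐ[ℚ] CyclotomicField 3 ℚ), c₀ ≠ 1 →
      Module.finrank (CyclotomicField 3 ℚ) L = 2 → ∀ (s : L) (c : L ≃ₐ[ℚ] L), s ^ 2 = -2 → c s = -s →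
      (∀ x : CyclotomicField 3 ℚ,
        c (algebraMap (CyclotomicField 3 ℚ) L x) = algebraMap (CyclotomicField 3 ℚ) L (c₀ x)) →
      ∀ φ : L →+* ℂ, ComplexEmbedding.conjugate φ = φ.comp (c : L →+* L) := by
  intro L _ _ _ c₀ hc₀ h2 s c hs hcs hcc₀ φ
  exact conjugate_eq_comp_of_finrank_eq_two h2 hs c hcs c₀ hc₀ hcc₀ φ

end Summit.Langlands.Langlands.Theorems.IrregularClassicality.SplitRamifiedPrimeSqrt6

end
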